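import Summits.KontsevichZagierPeriods.Zeta5Search.RVFlatGaugeZoneCRows
import Summits.KontsevichZagierPeriods.Zeta5Search.BigPrimeMinors
import HarnessLib

/-!
# ζ(5) search — the contiguity minors are PARTNER-FREE: normal form `Cas_j(b) = Cas(b)` for all seven partners `j`

Cell `pub-zeta5` (HONEST FRAMING: systematic search; no irrationality claim unless certified), family seat `fam-rv`
(Rhin–Viola / flat-`S₇`-gauge line), generation 13, item (29c-i) of the unit HANDOFF.  A STRUCTURAL THEOREM about the
objects of every zone law of this line (`CasoratianValuation.casoratian`, `RVFlatGauge.classRow`, `RVFlatGauge.multiRows`):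
they do not depend on the contiguity partner `j`.

THE OBSERVATION (gen 13, exact on the 848 zone-C residual instances at `p = 5`, then proved here for all `b`).  Raising the
lower parameter `b_j ↦ b_j + 1` multiplies the summand of the dual series by a quadratic polynomial,
`R_{b+e_j}(y) = (y + b_j)(y + b₀ − b_j) · R_b(y)`, and `(y + b_j)(y + b₀ − b_j) = y(y + b₀) + b_j(b₀ − b_j)` differs from the
partner-free multiplier `y(y + b₀)` by a CONSTANT.  Partial-fraction data transport along such a multiplication by an explicit
triangular rule (`linMul`, `shiftData`; the polynomial part that drops out is `Σ_q c_{0,q} = 0`, Cresson–Fischler–Rivoal's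
`sum_pf_data_zero`, used twice), so for every coefficient functional `Φ ∈ {U, W, V, 𝒦_x}` (all linear in the data)
`Φ(b + e_j) = Φ^core(b) + b_j(b₀ − b_j)·Φ(b)` (`coeffU_shift`, `coeffW_shift`, `coeffV_shift`, `classK_shift`), and every 2×2 minor
of two such functionals loses the partner:  `Cas_j(b) = W^core(b)V(b) − W(b)V^core(b) =: casCore b` (`casoratian_eq_casCore`),
likewise `minorQ`, `minorPhat`, every row `classRow b j p x` (`classRow_eq_rowCore`) and `multiRows b j p` (`multiRows_eq_multiCore`).
Hypotheses: `b` in the integer box with the convergence margin `Σ_j b_j ≤ 3b₀ + 1` (implied by `InPolytope b`) and `1 ≤ j ≤ 7`;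
NO hypothesis on `b + e_j`.

CONSEQUENCES for the line (recorded in `families/rv/FAMILY.md` §23): (i) the zone laws `TwoLongClassLaw`, `ZoneCMultiRowLaw`, (CV) …
are statements about `b` alone — the binders `j`, `InPolytope (shift b j)` only assert that some partner exists; (ii) every census and
every kernel certificate may be taken over `b` instead of `(b, j)` (factor ≈ 3 on zone C); (iii) the normal form of the open node (R1) is
`v_p(𝒦_M^core(b)·V(b) − 𝒦_M(b)·V^core(b)) ≥ node`, a statement about ONE rational function `R_b` and its multiple `y(y+b₀)R_b`
(equivalently `(y + b₀/2)² R_b`: the central class is suppressed by `p²`).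

Provenance: planner seat `planner-pub-zeta5-fam-rv-g13-0`; exact numerics `pub-zeta5-fam-rv/gen13/kappa1.py` (0/848 partner
dependence).  Identities between rational numbers; nothing here concerns irrationality.
-/

noncomputable section

open Finset Polynomial

namespace Summit.KontsevichZagierPeriods.Zeta5Search.RVFlatGauge

open Literature.NumberTheory.Transcendental.BallRivoal (pfEval harm poch)
open Literature.NumberTheory.Irrationality.CressonFischlerRivoal2008 (sum_pf_data_zero)
open Summit.KontsevichZagierPeriods.Zeta5Search.DualSeries (InBox numPoly natDegree_numPoly_le eval_numPoly)
open Summit.KontsevichZagierPeriods.Zeta5Search.WedgeDictionary (IsPFData pfData isPFData_pfData exists_isPFData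
  coeffU coeffW coeffV natDegree_numPoly_add_two_le)
open Summit.KontsevichZagierPeriods.Zeta5Search.CasoratianValuation (casoratian shift InPolytope minorQ minorPhat pairFloors
  refund)
open Summit.KontsevichZagierPeriods.Zeta5Search.BigPrime (shift_zero polytope_hyps)
open Summit.KontsevichZagierPeriods.Zeta5Search.ClusterValuation
open Summit.KontsevichZagierPeriods.Zeta5Search.WedgeDictionary (dOf)
open Summit.KontsevichZagierPeriods.Zeta5Search.SymmetricGauge (GaugeLaw28 rhoB m5 eD)
open Cap ZoneC
/-! ### Transport of partial-fraction data along multiplication by a linear factor -/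
/-- Partial-fraction data of `(y + a)·F` from data `c` of `F` (`y = t + 1`; at the pole `u = t + q + 1 = y + q` one has
`y + a = u + (a − q)`, so `(y + a) · c_{o,q} u^{−(o+1)} = c_{o,q} u^{−o} + (a − q) c_{o,q} u^{−(o+1)}`): the new coefficient of
`u^{−(o+1)}` is `(a − q) c_{o,q} + c_{o+1,q}` (orders `o < 6`; the term `c_{0,q} u^{0}` is the polynomial part that drops out). -/
def linMul (a : ℚ) (c : ℕ → ℕ → ℚ) (o q : ℕ) : ℚ :=
  (a - q) * c o q + if o < 5 then c (o + 1) q else 0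

/-- **Evaluation of the transported data**: `pfEval(linMul a c)(t) = (t + 1 + a)·pfEval(c)(t) − Σ_q c_{0,q}` away from the poles. -/
theorem pfEval_linMul (B : ℕ) (a : ℚ) (c : ℕ → ℕ → ℚ) (t : ℚ) (ht : ∀ q, q ≤ B → t + q + 1 ≠ 0) :
    pfEval B 6 (linMul a c) t = (t + 1 + a) * pfEval B 6 c t - ∑ q ∈ range (B + 1), c 0 q := by
  unfold pfEval
  rw [Finset.mul_sum, ← Finset.sum_sub_distrib]
  refine Finset.sum_congr rfl fun q hq => ?_
  have hu : t + q + 1 ≠ 0 := ht q (Nat.lt_succ_iff.1 (mem_range.1 hq))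
  simp only [Finset.sum_range_succ, Finset.sum_range_zero, zero_add, linMul]
  norm_num
  field_simp
  ring

/-- Data of `(y + m)(y + n − m)·F` from data of `F`: the transport along the contiguous shift `b ↦ b + e_j` (`n = b₀`, `m = b_j`). -/
def shiftData (n m : ℚ) (c : ℕ → ℕ → ℚ) : ℕ → ℕ → ℚ := linMul (n - m) (linMul m c)

/-- **The partner enters only through a constant**: `shiftData n m c = shiftData n 0 c + m(n − m)·c` pointwise
(`(y + m)(y + n − m) = y(y + n) + m(n − m)`). -/
theorem shiftData_eq (n m : ℚ) (c : ℕ → ℕ → ℚ) (o q : ℕ) :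
    shiftData n m c o q = shiftData n 0 c o q + m * (n - m) * c o q := by
  unfold shiftData linMul
  split_ifs <;> ring
/-! ### The summand of `b + e_j` is a quadratic multiple of the summand of `b` -/
/-- `(t)_{M+1} = (t)_M · (t + M)`. -/
theorem poch_succ_right (t : ℚ) (M : ℕ) : poch t (M + 1) = poch t M * (t + M) := Finset.prod_range_succ _ _

/-- `(t)_{M+1} = t · (t+1)_M`. -/
theorem poch_succ_left (t : ℚ) (M : ℕ) : poch t (M + 1) = t * poch (t + 1) M := by
  rw [poch, poch, Finset.prod_range_succ', Nat.cast_zero, add_zero, mul_comm]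
  congr 1
  refine Finset.prod_congr rfl fun s _ => ?_
  push_cast
  ring

/-- **`numPoly (b + e_j) = numPoly b · (X + b_j)(X + b₀ − b_j)`** (as an identity of evaluations): raising `b_j` by one extends
the two Pochhammer factors `(X)_{b_j} (X + b₀ − b_j + 1)_{b_j}` by `X + b_j` and `X + b₀ − b_j`. -/
theorem numPoly_shift_eval (b : ℕ → ℤ) (hb : InBox b) {j : ℕ} (hj1 : 1 ≤ j) (hj7 : j ≤ 7) (t : ℚ) :
    (numPoly (shift b j)).eval t = (numPoly b).eval t * ((t + (b j : ℚ)) * (t + ((b 0 : ℚ) - b j))) := by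
  obtain ⟨i, rfl⟩ : ∃ i, j = i + 1 := ⟨j - 1, by omega⟩
  have hi : i ∈ range 7 := mem_range.2 (by omega)
  have hbi : 0 ≤ b (i + 1) := (hb.2 i hi).1
  rw [eval_numPoly, eval_numPoly, shift_zero b hj1]
  rw [← Finset.mul_prod_erase (range 7) _ hi, ← Finset.mul_prod_erase (range 7)
    (fun k => poch t (b (k + 1)).toNat * poch (t + ((b 0 - b (k + 1) + 1 : ℤ) : ℚ)) (b (k + 1)).toNat) hi]
  have hrest : ∏ k ∈ (range 7).erase i, poch t (shift b (i + 1) (k + 1)).toNat *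
        poch (t + ((b 0 - shift b (i + 1) (k + 1) + 1 : ℤ) : ℚ)) (shift b (i + 1) (k + 1)).toNat =
      ∏ k ∈ (range 7).erase i, poch t (b (k + 1)).toNat *
        poch (t + ((b 0 - b (k + 1) + 1 : ℤ) : ℚ)) (b (k + 1)).toNat := by
    refine Finset.prod_congr rfl fun k hk => ?_
    have hk' : k + 1 ≠ i + 1 := by have := (Finset.mem_erase.1 hk).1; omega
    rw [show shift b (i + 1) (k + 1) = b (k + 1) from Function.update_of_ne hk' _ _]
  have hself : shift b (i + 1) (i + 1) = b (i + 1) + 1 := Function.update_self _ _ _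
  rw [hrest, hself]
  set M := (b (i + 1)).toNat with hM
  have hMz : (b (i + 1) : ℤ) = (M : ℤ) := (Int.toNat_of_nonneg hbi).symm
  have hM1 : (b (i + 1) + 1).toNat = M + 1 := by
    have h := Int.toNat_add_nat hbi 1
    simpa [hM] using h
  have hfac : poch t (b (i + 1) + 1).toNat * poch (t + ((b 0 - (b (i + 1) + 1) + 1 : ℤ) : ℚ)) (b (i + 1) + 1).toNat =
      poch t M * poch (t + ((b 0 - b (i + 1) + 1 : ℤ) : ℚ)) M * ((t + (b (i + 1) : ℚ)) * (t + ((b 0 : ℚ) - b (i + 1)))) := by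
    rw [hM1, hMz, poch_succ_right, poch_succ_left]
    push_cast
    ring_nf
  rw [hfac, hMz]
  push_cast
  ring
/-! ### Transport of `IsPFData` along the shift -/
/-- The degree margin `deg numPoly_b + 3 ≤ 6(b₀+1)` on the box with `Σ_j b_j ≤ 3b₀ + 1` (one more than Cresson–Fischler–Rivoal need:
room for one linear factor). -/
theorem natDegree_numPoly_add_three_le (b : ℕ → ℤ) (hb : InBox b)
    (hsum : ∑ j ∈ range 7, b (j + 1) ≤ 3 * b 0 + 1) :
    (numPoly b).natDegree + 3 ≤ 6 * ((b 0).toNat + 1) := by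
  obtain ⟨h0, hj⟩ := hb
  have hb0 : (b 0 : ℤ) = ((b 0).toNat : ℤ) := (Int.toNat_of_nonneg h0).symm
  have hS : ∑ j ∈ range 7, b (j + 1) = ((∑ j ∈ range 7, (b (j + 1)).toNat : ℕ) : ℤ) := by
    rw [Nat.cast_sum]
    exact sum_congr rfl fun j hj' => (Int.toNat_of_nonneg (hj j hj').1).symm
  have h1 := natDegree_numPoly_le b
  have h2 : ((∑ j ∈ range 7, (b (j + 1)).toNat : ℕ) : ℤ) ≤ 3 * ((b 0).toNat : ℤ) + 1 := by
    rw [← hS, ← hb0]; exact hsum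
  omega

/-- `Σ_q c_{0,q} = 0` for ANY partial-fraction data of `R_b` (the polar part at infinity; Cresson–Fischler–Rivoal). -/
theorem sum_order_zero_of_isPFData (b : ℕ → ℤ) (hb : InBox b) (hsum : ∑ j ∈ range 7, b (j + 1) ≤ 3 * b 0 + 1)
    {c : ℕ → ℕ → ℚ} (hc : IsPFData b c) : ∑ q ∈ range ((b 0).toNat + 1), c 0 q = 0 := by
  have hnat : ((numPoly b).comp (X + C 1)).natDegree = (numPoly b).natDegree := by
    rw [natDegree_comp, natDegree_X_add_C, mul_one]
  have h2 := natDegree_numPoly_add_two_le b hb hsum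
  exact sum_pf_data_zero (b 0).toNat 6 (by norm_num) _ (by rw [hnat]; exact h2) c hc

/-- The once-transported data are data of `(y + m)·R_b = numPoly_b(t+1)(t+1+m)/(t+1)_{b₀+1}^6`. -/
theorem pfEval_linMul_of_isPFData (b : ℕ → ℤ) (hb : InBox b) (hsum : ∑ j ∈ range 7, b (j + 1) ≤ 3 * b 0 + 1)
    {c : ℕ → ℕ → ℚ} (hc : IsPFData b c) (m t : ℚ) (ht : ∀ q, q ≤ (b 0).toNat → t + q + 1 ≠ 0) :
    pfEval (b 0).toNat 6 (linMul m c) t =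
      ((numPoly b).comp (X + C 1) * (X + C (1 + m))).eval t / poch (t + 1) ((b 0).toNat + 1) ^ 6 := by
  rw [pfEval_linMul _ _ _ _ ht, sum_order_zero_of_isPFData b hb hsum hc, sub_zero, hc t ht, eval_mul, eval_add, eval_X,
    eval_C]
  ring

/-- … hence their order-zero coefficients also sum to zero (one linear factor still fits under the degree margin). -/
theorem sum_linMul_order_zero (b : ℕ → ℤ) (hb : InBox b) (hsum : ∑ j ∈ range 7, b (j + 1) ≤ 3 * b 0 + 1)
    {c : ℕ → ℕ → ℚ} (hc : IsPFData b c) (m : ℚ) : ∑ q ∈ range ((b 0).toNat + 1), linMul m c 0 q = 0 := by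
  have hnat : ((numPoly b).comp (X + C 1) * (X + C (1 + m))).natDegree ≤ (numPoly b).natDegree + 1 := by
    refine natDegree_mul_le.trans ?_
    rw [natDegree_comp, natDegree_X_add_C, natDegree_X_add_C, mul_one]
  have h3 := natDegree_numPoly_add_three_le b hb hsum
  exact sum_pf_data_zero (b 0).toNat 6 (by norm_num) _ (by omega) (linMul m c)
    (fun t ht => pfEval_linMul_of_isPFData b hb hsum hc m t ht)

/-- **TRANSPORT**: if `c` are partial-fraction data of `R_b`, then `shiftData b₀ b_j c` are partial-fraction data of `R_{b+e_j}`
(`1 ≤ j ≤ 7`; nothing is assumed about `b + e_j`). -/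
theorem isPFData_shift (b : ℕ → ℤ) (hb : InBox b) (hsum : ∑ j ∈ range 7, b (j + 1) ≤ 3 * b 0 + 1) {j : ℕ}
    (hj1 : 1 ≤ j) (hj7 : j ≤ 7) {c : ℕ → ℕ → ℚ} (hc : IsPFData b c) :
    IsPFData (shift b j) (shiftData (b 0) (b j) c) := by
  intro t ht
  rw [shift_zero b hj1] at ht ⊢
  rw [shiftData, pfEval_linMul _ _ _ _ ht, sum_linMul_order_zero b hb hsum hc, sub_zero,
    pfEval_linMul_of_isPFData b hb hsum hc _ t ht]
  simp only [eval_comp, eval_mul, eval_add, eval_X, eval_C]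
  rw [numPoly_shift_eval b hb hj1 hj7]
  ring

/-- **The canonical coefficients of `b + e_j` from those of `b`**: `pfData (b+e_j) = shiftData b₀ b_j (pfData b)` on the support. -/
theorem pfData_shift (b : ℕ → ℤ) (hb : InBox b) (hsum : ∑ j ∈ range 7, b (j + 1) ≤ 3 * b 0 + 1) {j : ℕ}
    (hj1 : 1 ≤ j) (hj7 : j ≤ 7) {o q : ℕ} (ho : o < 6) (hq : q ≤ (b 0).toNat) :
    pfData (shift b j) o q = shiftData (b 0) (b j) (pfData b) o q := by
  obtain ⟨c, hc⟩ := exists_isPFData b hb hsum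
  have hc' : IsPFData b (pfData b) := isPFData_pfData hc
  have hs := isPFData_shift b hb hsum hj1 hj7 hc'
  have hq' : q ≤ (shift b j 0).toNat := by rw [shift_zero b hj1]; exact hq
  exact (isPFData_pfData hs).eq hs ho hq'
/-! ### The partner-free cores and the shift formulas for `U`, `W`, `V`, `𝒦_x` -/
/-- The CORE data: data of `y(y + b₀)·R_b` (the virtual partner `b_j = 0`). -/
def coreData (b : ℕ → ℤ) : ℕ → ℕ → ℚ := shiftData (b 0) 0 (pfData b)

/-- `U^core(b) = Σ_q coreData_{4,q}`. -/
def coreU (b : ℕ → ℤ) : ℚ := ∑ q ∈ range ((b 0).toNat + 1), coreData b 4 q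

/-- `W^core(b) = Σ_q coreData_{2,q}`. -/
def coreW (b : ℕ → ℤ) : ℚ := ∑ q ∈ range ((b 0).toNat + 1), coreData b 2 q

/-- `V^core(b) = Σ_{o,q} coreData_{o,q} H_q^{(o+1)}`. -/
def coreV (b : ℕ → ℤ) : ℚ := ∑ o ∈ range 6, ∑ q ∈ range ((b 0).toNat + 1), coreData b o q * harm (o + 1) q

/-- `𝒦_x^core(b)`: the class-`x` residue piece computed from the core data. -/
def coreK (b : ℕ → ℤ) (p x : ℕ) : ℚ :=
  ∑ q ∈ classSet b p x, ∑ o ∈ range 6,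
    coreData b o q * ((taylorTT p o ((q : ℤ) + 1) : ℚ) - if o = 2 then 1 else 0)

/-- **`U(b + e_j) = U^core(b) + b_j(b₀ − b_j)·U(b)`.** -/
theorem coeffU_shift (b : ℕ → ℤ) (hb : InBox b) (hsum : ∑ j ∈ range 7, b (j + 1) ≤ 3 * b 0 + 1) {j : ℕ}
    (hj1 : 1 ≤ j) (hj7 : j ≤ 7) : coeffU (shift b j) = coreU b + (b j : ℚ) * ((b 0 : ℚ) - b j) * coeffU b := by
  unfold coeffU coreU
  rw [shift_zero b hj1, Finset.mul_sum, ← Finset.sum_add_distrib]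
  refine Finset.sum_congr rfl fun q hq => ?_
  rw [pfData_shift b hb hsum hj1 hj7 (by norm_num) (Nat.lt_succ_iff.1 (mem_range.1 hq)), coreData, shiftData_eq]

/-- **`W(b + e_j) = W^core(b) + b_j(b₀ − b_j)·W(b)`.** -/
theorem coeffW_shift (b : ℕ → ℤ) (hb : InBox b) (hsum : ∑ j ∈ range 7, b (j + 1) ≤ 3 * b 0 + 1) {j : ℕ}
    (hj1 : 1 ≤ j) (hj7 : j ≤ 7) : coeffW (shift b j) = coreW b + (b j : ℚ) * ((b 0 : ℚ) - b j) * coeffW b := by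
  unfold coeffW coreW
  rw [shift_zero b hj1, Finset.mul_sum, ← Finset.sum_add_distrib]
  refine Finset.sum_congr rfl fun q hq => ?_
  rw [pfData_shift b hb hsum hj1 hj7 (by norm_num) (Nat.lt_succ_iff.1 (mem_range.1 hq)), coreData, shiftData_eq]

/-- **`V(b + e_j) = V^core(b) + b_j(b₀ − b_j)·V(b)`.** -/
theorem coeffV_shift (b : ℕ → ℤ) (hb : InBox b) (hsum : ∑ j ∈ range 7, b (j + 1) ≤ 3 * b 0 + 1) {j : ℕ}
    (hj1 : 1 ≤ j) (hj7 : j ≤ 7) : coeffV (shift b j) = coreV b + (b j : ℚ) * ((b 0 : ℚ) - b j) * coeffV b := by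
  unfold coeffV coreV
  rw [shift_zero b hj1, Finset.mul_sum, ← Finset.sum_add_distrib]
  refine Finset.sum_congr rfl fun o ho => ?_
  rw [Finset.mul_sum, ← Finset.sum_add_distrib]
  refine Finset.sum_congr rfl fun q hq => ?_
  rw [pfData_shift b hb hsum hj1 hj7 (mem_range.1 ho) (Nat.lt_succ_iff.1 (mem_range.1 hq)), coreData, shiftData_eq]
  ring

/-- **`𝒦_x(b + e_j) = 𝒦_x^core(b) + b_j(b₀ − b_j)·𝒦_x(b)`** for every residue class `x` modulo any `p`. -/
theorem classK_shift (b : ℕ → ℤ) (hb : InBox b) (hsum : ∑ j ∈ range 7, b (j + 1) ≤ 3 * b 0 + 1) {j : ℕ}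
    (hj1 : 1 ≤ j) (hj7 : j ≤ 7) (p x : ℕ) :
    classK (shift b j) p x = coreK b p x + (b j : ℚ) * ((b 0 : ℚ) - b j) * classK b p x := by
  unfold classK coreK
  rw [classSet_shift b hj1, Finset.mul_sum, ← Finset.sum_add_distrib]
  refine Finset.sum_congr rfl fun q hq => ?_
  have hqB : q ≤ (b 0).toNat := by
    have := (Finset.mem_filter.1 hq).1
    exact Nat.lt_succ_iff.1 (mem_range.1 this)
  rw [Finset.mul_sum, ← Finset.sum_add_distrib]
  refine Finset.sum_congr rfl fun o ho => ?_
  rw [pfData_shift b hb hsum hj1 hj7 (mem_range.1 ho) hqB, coreData, shiftData_eq]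
  ring
/-! ### The minors and the rows are partner-free -/
/-- The partner-free Casoratian `Cas(b) := W^core(b)·V(b) − W(b)·V^core(b)`. -/
def casCore (b : ℕ → ℤ) : ℚ := coreW b * coeffV b - coeffW b * coreV b

/-- The partner-free `Q`-minor `U(b)·W^core(b) − U^core(b)·W(b)`. -/
def minorQCore (b : ℕ → ℤ) : ℚ := coeffU b * coreW b - coreU b * coeffW b

/-- The partner-free `P̂`-minor `U(b)·V^core(b) − U^core(b)·V(b)`. -/
def minorPhatCore (b : ℕ → ℤ) : ℚ := coeffU b * coreV b - coreU b * coeffV b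

/-- The partner-free row of the class `x`: `𝒦_x^core(b)·V(b) − 𝒦_x(b)·V^core(b)`. -/
def rowCore (b : ℕ → ℤ) (p x : ℕ) : ℚ := coreK b p x * coeffV b - classK b p x * coreV b

/-- The partner-free multipole rows. -/
def multiCore (b : ℕ → ℤ) (p : ℕ) : ℚ := ∑ x ∈ multipoleClasses b p, rowCore b p x

/-- **NORMAL FORM OF THE CASORATIAN**: `Cas_j(b) = Cas(b)` for every partner `1 ≤ j ≤ 7`, for every `b` in the box with
`Σ_j b_j ≤ 3b₀ + 1`. -/
theorem casoratian_eq_casCore (b : ℕ → ℤ) (hb : InBox b) (hsum : ∑ j ∈ range 7, b (j + 1) ≤ 3 * b 0 + 1) {j : ℕ}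
    (hj1 : 1 ≤ j) (hj7 : j ≤ 7) : casoratian b j = casCore b := by
  unfold casoratian casCore
  rw [coeffW_shift b hb hsum hj1 hj7, coeffV_shift b hb hsum hj1 hj7]
  ring

/-- **THE CASORATIAN IS PARTNER-FREE**: `Cas_j(b) = Cas_k(b)` for all `1 ≤ j, k ≤ 7`. -/
theorem casoratian_partner_free (b : ℕ → ℤ) (hb : InBox b) (hsum : ∑ j ∈ range 7, b (j + 1) ≤ 3 * b 0 + 1) {j k : ℕ}
    (hj1 : 1 ≤ j) (hj7 : j ≤ 7) (hk1 : 1 ≤ k) (hk7 : k ≤ 7) : casoratian b j = casoratian b k := by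
  rw [casoratian_eq_casCore b hb hsum hj1 hj7, casoratian_eq_casCore b hb hsum hk1 hk7]

/-- The same on the Brown–Zudilin polytope (the hypothesis of every zone law). -/
theorem casoratian_partner_free_of_inPolytope (b : ℕ → ℤ) (hb : InPolytope b) {j k : ℕ}
    (hj1 : 1 ≤ j) (hj7 : j ≤ 7) (hk1 : 1 ≤ k) (hk7 : k ≤ 7) : casoratian b j = casoratian b k := by
  obtain ⟨hbox, -, hs⟩ := polytope_hyps b hb
  exact casoratian_partner_free b hbox hs hj1 hj7 hk1 hk7

/-- **The `Q`-minor is partner-free**: `minorQ b j = minorQCore b`. -/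
theorem minorQ_eq_core (b : ℕ → ℤ) (hb : InBox b) (hsum : ∑ j ∈ range 7, b (j + 1) ≤ 3 * b 0 + 1) {j : ℕ}
    (hj1 : 1 ≤ j) (hj7 : j ≤ 7) : minorQ b j = minorQCore b := by
  unfold minorQ minorQCore
  rw [coeffU_shift b hb hsum hj1 hj7, coeffW_shift b hb hsum hj1 hj7]
  ring

/-- **The `P̂`-minor is partner-free**: `minorPhat b j = minorPhatCore b`. -/
theorem minorPhat_eq_core (b : ℕ → ℤ) (hb : InBox b) (hsum : ∑ j ∈ range 7, b (j + 1) ≤ 3 * b 0 + 1) {j : ℕ}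
    (hj1 : 1 ≤ j) (hj7 : j ≤ 7) : minorPhat b j = minorPhatCore b := by
  unfold minorPhat minorPhatCore
  rw [coeffU_shift b hb hsum hj1 hj7, coeffV_shift b hb hsum hj1 hj7]
  ring

/-- **Every row is partner-free**: `classRow b j p x = rowCore b p x`. -/
theorem classRow_eq_rowCore (b : ℕ → ℤ) (hb : InBox b) (hsum : ∑ j ∈ range 7, b (j + 1) ≤ 3 * b 0 + 1) {j : ℕ}
    (hj1 : 1 ≤ j) (hj7 : j ≤ 7) (p x : ℕ) : classRow b j p x = rowCore b p x := by
  unfold classRow rowCore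
  rw [classK_shift b hb hsum hj1 hj7, coeffV_shift b hb hsum hj1 hj7]
  ring

/-- **The multipole rows are partner-free**: `multiRows b j p = multiCore b p` — the open node (R1) `ZoneCMultiRowLaw` is a statement
about `b` alone. -/
theorem multiRows_eq_multiCore (b : ℕ → ℤ) (hb : InBox b) (hsum : ∑ j ∈ range 7, b (j + 1) ≤ 3 * b 0 + 1) {j : ℕ}
    (hj1 : 1 ≤ j) (hj7 : j ≤ 7) (p : ℕ) : multiRows b j p = multiCore b p := by
  unfold multiRows multiCore
  exact Finset.sum_congr rfl fun x _ => classRow_eq_rowCore b hb hsum hj1 hj7 p x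

/-- (R1) restated on the normal form: it suffices to bound ONE rational number per `(b, p)`. -/
theorem multiRows_partner_free (b : ℕ → ℤ) (hb : InPolytope b) {j k : ℕ} (hj1 : 1 ≤ j) (hj7 : j ≤ 7)
    (hk1 : 1 ≤ k) (hk7 : k ≤ 7) (p : ℕ) : multiRows b j p = multiRows b k p := by
  obtain ⟨hbox, -, hs⟩ := polytope_hyps b hb
  rw [multiRows_eq_multiCore b hbox hs hj1 hj7, multiRows_eq_multiCore b hbox hs hk1 hk7]
/-! ### (R1) in normal form: one rational number per `(b, p)` -/
/-- **(R1) IN NORMAL FORM** — the partner-free form of `ZoneCMultiRowLaw`: for `b` on zone C admitting SOME contiguous partner in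
the polytope, `v_p(Σ_{x ∈ M} 𝒦_x^core(b)·V(b) − 𝒦_x(b)·V^core(b)) ≥ min(1,⌊d/p⌋) − N_p + max(Γ,0)`.  Equivalent to `ZoneCMultiRowLaw`
(`zoneCMultiRowLaw_iff_coreLaw`); its census runs over `b` (not `(b, j)`).  OPEN. -/
@[conjecture] def ZoneCMultiCoreLaw : Prop :=
  ∀ (b : ℕ → ℤ) (p i₁ i₂ : ℕ), InPolytope b → (∃ j, 1 ≤ j ∧ j ≤ 7 ∧ InPolytope (shift b j)) → p.Prime → 5 ≤ p →
    b 0 < 3 * (p : ℤ) → i₁ < 7 → i₂ < 7 → i₁ ≠ i₂ → (p : ℤ) ≤ b 0 - 2 * b (i₁ + 1) → (p : ℤ) ≤ b 0 - 2 * b (i₂ + 1) →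
    b (i₁ + 1) ≤ b (i₂ + 1) → (∀ k ∈ ((range 7).erase i₁).erase i₂, b 0 - 2 * b (k + 1) < p) → multiCore b p ≠ 0 →
      refund b p - pairFloors b p + zcBonus b p i₁ i₂ ≤ padicValRat p (multiCore b p)

/-- **(R1) ⟺ its normal form.** -/
theorem zoneCMultiRowLaw_iff_coreLaw : ZoneCMultiRowLaw ↔ ZoneCMultiCoreLaw := by
  constructor
  · intro h b p i₁ i₂ hb hj hp hp5 hn h1 h2 h12 hl1 hl2 hle hshort hne
    obtain ⟨j, hj1, hj7, hbj⟩ := hj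
    obtain ⟨hbox, -, hs⟩ := polytope_hyps b hb
    rw [← multiRows_eq_multiCore b hbox hs hj1 hj7] at hne ⊢
    exact h b j p i₁ i₂ hb hj1 hj7 hbj hp hp5 hn h1 h2 h12 hl1 hl2 hle hshort hne
  · intro h b j p i₁ i₂ hb hj1 hj7 hbj hp hp5 hn h1 h2 h12 hl1 hl2 hle hshort hne
    obtain ⟨hbox, -, hs⟩ := polytope_hyps b hb
    rw [multiRows_eq_multiCore b hbox hs hj1 hj7] at hne ⊢
    exact h b p i₁ i₂ hb ⟨j, hj1, hj7, hbj⟩ hp hp5 hn h1 h2 h12 hl1 hl2 hle hshort hne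

/-- Hence the gen-12 reduction reads: the normal-form law and the (VΓ) guard give the two-long-class law. -/
theorem twoLongClassLaw_of_coreLaw (hR : ZoneCMultiCoreLaw) (hV : ZoneCConstantTermBonus) : TwoLongClassLaw :=
  twoLongClassLaw_of_rowLaws (zoneCMultiRowLaw_iff_coreLaw.2 hR) hV

/-- **THE TWO-LONG-CLASS LAW IN NORMAL FORM** (partner-free form of `TwoLongClassLaw`): on zone C,
`v_p(Cas(b)) ≥ min(1,⌊d/p⌋) − N_p + max(Γ,0)` for every `b` admitting some contiguous partner in the polytope.  OPEN (⟺ `TwoLongClassLaw`). -/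
@[conjecture] def TwoLongClassCoreLaw : Prop :=
  ∀ (b : ℕ → ℤ) (p i₁ i₂ : ℕ), InPolytope b → (∃ j, 1 ≤ j ∧ j ≤ 7 ∧ InPolytope (shift b j)) → p.Prime → 5 ≤ p →
    b 0 < 3 * (p : ℤ) → i₁ < 7 → i₂ < 7 → i₁ ≠ i₂ →
    (p : ℤ) ≤ b 0 - 2 * b (i₁ + 1) → (p : ℤ) ≤ b 0 - 2 * b (i₂ + 1) → b (i₁ + 1) ≤ b (i₂ + 1) →
    (∀ k ∈ ((range 7).erase i₁).erase i₂, b 0 - 2 * b (k + 1) < p) → casCore b ≠ 0 →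
    refund b p - pairFloors b p + zcBonus b p i₁ i₂ ≤ padicValRat p (casCore b)

/-- **`TwoLongClassLaw` ⟺ its normal form.** -/
theorem twoLongClassLaw_iff_coreLaw : TwoLongClassLaw ↔ TwoLongClassCoreLaw := by
  constructor
  · intro h b p i₁ i₂ hb hj hp hp5 hn h1 h2 h12 hl1 hl2 hle hshort hne
    obtain ⟨j, hj1, hj7, hbj⟩ := hj
    obtain ⟨hbox, -, hs⟩ := polytope_hyps b hb
    rw [← casoratian_eq_casCore b hbox hs hj1 hj7] at hne ⊢
    exact h b j p i₁ i₂ hb hj1 hj7 hbj hp hp5 hn h1 h2 h12 hl1 hl2 hle hshort hne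
  · intro h b j p i₁ i₂ hb hj1 hj7 hbj hp hp5 hn h1 h2 h12 hl1 hl2 hle hshort hne
    obtain ⟨hbox, -, hs⟩ := polytope_hyps b hb
    rw [casoratian_eq_casCore b hbox hs hj1 hj7] at hne ⊢
    exact h b p i₁ i₂ hb ⟨j, hj1, hj7, hbj⟩ hp hp5 hn h1 h2 h12 hl1 hl2 hle hshort hne

/-- The usable direction as an implication: the normal-form law gives `TwoLongClassLaw`. -/
theorem twoLongClassLaw_of_twoLongClassCoreLaw (h : TwoLongClassCoreLaw) : TwoLongClassLaw :=
  twoLongClassLaw_iff_coreLaw.2 h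
/-! ### The Brown–Zudilin law (28) in normal form -/
/-- **(28) IN NORMAL FORM** — the partner-free form of the cell's record-bearing open law `SymmetricGauge.GaugeLaw28`
(`v_p Cas_j(b) ≥ −e_D(b) − v_p ρ(b)` on the polytope with `d ≤ 2m₅`): ONE inequality per `(b, p)`,
`v_p(W^core(b)V(b) − W(b)V^core(b)) ≥ −e_D(b) − v_p ρ(b)`, for every `b` admitting some contiguous partner in the polytope.
OPEN; ⟺ `GaugeLaw28` (`gaugeLaw28_iff_coreLaw`), so every census / certificate of (28) may run over `b` instead of `(b, j)`. -/
@[conjecture] def GaugeLaw28Core : Prop :=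
  ∀ (b : ℕ → ℤ) (p : ℕ), InPolytope b → (∃ j, 1 ≤ j ∧ j ≤ 7 ∧ InPolytope (shift b j)) → dOf b ≤ 2 * m5 b →
    p.Prime → 5 ≤ p → casCore b ≠ 0 → -eD b p - padicValRat p (rhoB b) ≤ padicValRat p (casCore b)

/-- **`GaugeLaw28` ⟺ its normal form.** -/
theorem gaugeLaw28_iff_coreLaw : GaugeLaw28 ↔ GaugeLaw28Core := by
  constructor
  · intro h b p hb hj hd hp hp5 hne
    obtain ⟨j, hj1, hj7, hbj⟩ := hj
    obtain ⟨hbox, -, hs⟩ := polytope_hyps b hb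
    rw [← casoratian_eq_casCore b hbox hs hj1 hj7] at hne ⊢
    exact h b j p hb hj1 hj7 hbj hd hp hp5 hne
  · intro h b j p hb hj1 hj7 hbj hd hp hp5 hne
    obtain ⟨hbox, -, hs⟩ := polytope_hyps b hb
    rw [casoratian_eq_casCore b hbox hs hj1 hj7] at hne ⊢
    exact h b p hb ⟨j, hj1, hj7, hbj⟩ hd hp hp5 hne

/-- The usable direction as an implication: the normal-form law gives `GaugeLaw28` (and through
`PermutationSaving.symmetricGaugeLaw_of_gaugeLaw28'` whatever (28) gives). -/
theorem gaugeLaw28_of_gaugeLaw28Core (h : GaugeLaw28Core) : GaugeLaw28 :=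
  gaugeLaw28_iff_coreLaw.2 h

end Summit.KontsevichZagierPeriods.Zeta5Search.RVFlatGauge

end
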